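import Summits.QuantumFields.YangMills.Theorems.BalabanUVNodesN19TameHellingerLetterRegimeFree
import Summits.QuantumFields.YangMills.Theorems.BalabanUVNodesN19TameTiltLetterOfKPMargin

/-!
# BalabanUVNodes ∕ node N19 (NE7) — THE (H) LETTER OF A KEYED GAS FROM WILD MASSES AND ONE ONE-RUN KP MARGIN: regime-free, one-margin edition of p620730
# (idea-3's hellinger road; (KR)+(V‑b) abstract ⇒ (H), with the tame regime, the second KP margin and the second size bound DELETED)

Cell `pub-ymgap` (HUMAN RULING D-0062 Track A ∕ director-ym R399 (3a) second-wave width seats), WIDTH SEAT `pub-ymgap-dag-n19-w4` (node n19 = NE7),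
generation g8, CLAIM-2 ∕ INTENT-2 (FILE 2 of the regime-free edition; FILE 1 = `…N19TameHellingerLetterRegimeFree`).  Key item K3⁸ `SpineGivenEndpointR13SepCoPHV`
(stmt-QuantumFields-27366, skeleton v6 b4e55110ab73e679, stub 2 `stub_expansion13HV`; Params-free ⇒ version-free); filed `--kind proof --supports … --as helper`.
COUNT-NEUTRAL.  THEOREMS ONLY (0 `def`, 0 `instance`, 0 `notation`, 0 `sorry`).  ADDITIVE — imports FILE 1 and this seat's g6 p620730
`…N19TameTiltLetterOfKPMargin` (its `tiltLetter_of_kpMargin` ∕ `tameFamilies_eq_compatible_sdiff` ∕ `logRatio_prod_eq_sum` BY NAME); modifies nothing.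

WHAT.  p620730 (`one_sub_affinity_keyedGas_le_wildMass_add_kpMargins` ∕ `affinityDefectLetter_of_kpMargins`) supplies the tame-tilt block of the road's
K-summation from the KEYED POLYMER GAS: both runs' class weights multiplicative over one polymer family `Λ_K` ((KR)), wild classes = compatible families meeting
the over-aged set `O_{K,t}`, and — per run — a weighted real Kotecký–Preiss margin on the tame sub-gas `Λ_K ∖ O_{K,t}` at radius `r_K` absorbing the two-run
increment `e^{r_K|log b_γ − log a_γ|}` ((V‑b) spent on the radius), ONE size bound `𝔄` for BOTH runs, AND the tame regime `1 − 𝒜_tame ≤ 1∕16` from `K₀` on.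
FILE 1 showed the regime and the second tilt branch are idle once `r_K ≥ 2` (forced off a finite head by `Σ 1∕r_K < ∞`).  THIS FILE re-plugs p620730's
supplier accordingly: ONE run's tilted KP margin (run A's, the base of the interpolation `A^{1−s}B^s`), ONE size bound, NO regime.
* §1 ★★ `one_sub_affinity_keyedGas_le_wildMass_add_kpMargin` — ONE `(K,t)`, radius `r ≥ 2`: `1 − Σ_T √(p_A p_B) ≤ max(p_A(wild), p_B(wild)) + 4·Σ_{Λ∖O} asz_A ∕ r²`
  (p620730 §5 with `hKPb` and `hreg` DELETED; `tiltLetter_of_kpMargin` ONCE, then FILE 1 §2).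
* §2 ★★★ `affinityDefectLetter_of_kpMargin` — ALONG `K`: p620730 §6's binder list with `(hKPb) (h𝔄B) (K₀) (hreg)` DELETED ⇒ the same (H) letter
  `∃ η ≥ 0, Σ_K √η_K < ∞, 1 − 𝒜_K(t) ≤ η_K` (FILE 1 §3 `affinityDefectLetter_of_tameTilt` with `𝔅 := 2𝔄`); ★ `hellingerRate_of_kpMargin` (ρ-shape).
* §3 `toy_noPolymers` (A6: the antecedent of §1 is inhabited on the empty gas — no regime clause left to check).
Downstream BY NAME (not re-plugged here, one deletion each): dag-n20-w4's p623082 `affinityDefectLetter_of_slotDoms_and_kpMargins` ∕ `…_of_records_and_kpMargins`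
(two `SlotDom`s + p620730) and dag-n20-w5's capstone `exists_hybridNE7_of_affinityDefectLetter_and_response` ∕ `…_boundedCurrent` (ANY (H) supplier) — feed §2.

HONEST FRAMING.  [folklore] by-name composition on HYPOTHESIS SHAPES.  EVERY remaining letter — the multiplicative keyed structure (KR) (a structural READING of
[LF‑II] (1.79)–(1.83), NOT typed against the datum of record), run A's KP margin with the two-run increment in the exponent ((V‑b) = (YG), two-run, UNPRINTED for
d = 4), `𝔄`, the radii `Σ 1∕r_K < ∞`, the wild masses with `Σ√wm_K < ∞` ((V‑a), paper-read only) — is a HYPOTHESIS produced by nobody; what moves is three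
letters OFF p620730's list (second margin, second size bound, regime), nothing else; NO estimate of Bałaban's programme is proved; nothing of Bałaban's asserted
or instantiated (no `Provisos₁₃SepCoPH` tuple — K0⁷ OPEN); NE7 ∕ NE7b ∕ NE7c NOT PRINTED as two-run statements for d = 4 and NOT proved; N19 ∕ N20 ∕ N21 NOT
discharged; K3⁸ ∕ K3⁷ OPEN, not claimed; no summit statement is proved by this seat; counts UNMOVED (typed 28∕28 · discharged 5∕27, A 5∕28).  One finite
four-torus programme at fixed ε — NOT ℝ⁴, NOT infinite volume, NOT OS, NOT a mass gap, NOT the Clay problem (R4 closes the conditional finite-𝕋⁴ rung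
`BalabanLadder.UV` only).  0 `def`; 0 `sorry`; standard axioms; no cite tags.
-/

noncomputable section

namespace Summit.QuantumFields.YangMills.BalabanUVNodes.N19TameTiltLetterOfKPMarginRegimeFree

open Finset
open Literature.Probability.LatticeModels (IsCompatible)
open Summit.QuantumFields.YangMills.BalabanUVNodes.N19TameTiltLetterOfKPMargin
  (tiltLetter_of_kpMargin tameFamilies_eq_compatible_sdiff logRatio_prod_eq_sum)
open Summit.QuantumFields.YangMills.BalabanUVNodes.N19TameHellingerLetterRegimeFree
  (one_sub_affinity_classLaw_le_wildMass_add_tameTilt affinityDefectLetter_of_tameTilt)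
open Summit.QuantumFields.YangMills.BalabanUVNodes.N19TameConditionedHellingerLetterAlongK (exists_summable_sqrt_rate)

variable {P : Type*} [DecidableEq P] (inc : P → P → Prop) [DecidableRel inc]

/-! ## §1 ONE `(K,t)`: wild mass + ONE one-run KP margin on the tame sub-gas at radius `≥ 2` ⇒ the Hellinger letter, NO regime [folklore] -/

/-- **★★ THE ONE-`(K,t)` HELLINGER LETTER OF A KEYED GAS FROM WILD MASS AND ONE ONE-RUN KP MARGIN — NO REGIME** [folklore; = p620730
`one_sub_affinity_keyedGas_le_wildMass_add_kpMargins` with `hKPb` and `hreg` DELETED, radius asked `≥ 2`].  BOTH runs' keyed class weights multiplicative over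
the SAME finite polymer family `Λ` (`A_X = ∏ a_γ`, `B_X = ∏ b_γ`, `a, b > 0` — the abstract form of (KR)), an over-aged set `O` (its families = R2's wild set),
and for run A ALONE a weighted real KP margin on `Λ ∖ O` at radius `r ≥ 2` absorbing `e^{r·|log b_γ − log a_γ|}` (the abstract form of (V‑b)).  Then, with `T`
the compatible families of `Λ`, `p_A = A∕Σ_T A`, `p_B = B∕Σ_T B`:
`1 − Σ_T √(p_A p_B) ≤ max(p_A(wild), p_B(wild)) + 4·(Σ_{Λ∖O} asz_A)∕r²` — p620730's `tiltLetter_of_kpMargin` ONCE (`𝔅 = 2Σ asz_A`), then FILE 1 §2. -/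
theorem one_sub_affinity_keyedGas_le_wildMass_add_kpMargin [Std.Refl inc] [Std.Symm inc] (Λ O : Finset P)
    (a b aszA : P → ℝ) (ha : ∀ γ ∈ Λ, 0 < a γ) (hb : ∀ γ ∈ Λ, 0 < b γ) {r : ℝ} (hr : 2 ≤ r)
    (hKPa : ∀ γ ∈ Λ \ O, ∑ γ' ∈ (Λ \ O) with inc γ' γ,
      a γ' * Real.exp (r * |Real.log (b γ') - Real.log (a γ')|) * Real.exp (aszA γ') ≤ aszA γ) :
    1 - ∑ X ∈ Λ.powerset with IsCompatible inc X,
        Real.sqrt (((∏ γ ∈ X, a γ) / ∑ Y ∈ Λ.powerset with IsCompatible inc Y, ∏ γ ∈ Y, a γ)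
          * ((∏ γ ∈ X, b γ) / ∑ Y ∈ Λ.powerset with IsCompatible inc Y, ∏ γ ∈ Y, b γ))
      ≤ max ((∑ X ∈ (Λ.powerset.filter (fun X => IsCompatible inc X)).filter (fun X => ¬ Disjoint X O), ∏ γ ∈ X, a γ)
              / ∑ Y ∈ Λ.powerset with IsCompatible inc Y, ∏ γ ∈ Y, a γ)
            ((∑ X ∈ (Λ.powerset.filter (fun X => IsCompatible inc X)).filter (fun X => ¬ Disjoint X O), ∏ γ ∈ X, b γ)
              / ∑ Y ∈ Λ.powerset with IsCompatible inc Y, ∏ γ ∈ Y, b γ)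
        + 4 * (∑ γ ∈ Λ \ O, aszA γ) / r ^ 2 := by
  have hr0 : 0 < r := by linarith
  set T := Λ.powerset.filter (fun X => IsCompatible inc X) with hTdef
  set W := T.filter (fun X => ¬ Disjoint X O) with hWdef
  have hW : W ⊆ T := Finset.filter_subset _ _
  have hTW : T \ W = (Λ \ O).powerset.filter (fun X => IsCompatible inc X) := tameFamilies_eq_compatible_sdiff inc Λ O
  have hXΛ : ∀ X ∈ T, X ⊆ Λ := fun X hX => Finset.mem_powerset.1 (Finset.mem_filter.1 hX).1
  have hA : ∀ X ∈ T, 0 < ∏ γ ∈ X, a γ := fun X hX => Finset.prod_pos fun γ hγ => ha γ (hXΛ X hX hγ)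
  have hB : ∀ X ∈ T, 0 < ∏ γ ∈ X, b γ := fun X hX => Finset.prod_pos fun γ hγ => hb γ (hXΛ X hX hγ)
  have ha' : ∀ γ ∈ Λ \ O, 0 < a γ := fun γ hγ => ha γ (Finset.sdiff_subset hγ)
  have hb' : ∀ γ ∈ Λ \ O, 0 < b γ := fun γ hγ => hb γ (Finset.sdiff_subset hγ)
  -- the two-run increment `log B − log A` is additive on the compatible families of `Λ ∖ O` (p620730 §1)
  have hh : ∀ X ∈ (Λ \ O).powerset.filter (fun X => IsCompatible inc X),
      (fun X => Real.log (∏ γ ∈ X, b γ) - Real.log (∏ γ ∈ X, a γ)) X = ∑ γ ∈ X, (Real.log (b γ) - Real.log (a γ)) := by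
    intro X hX
    have hXs : X ⊆ Λ \ O := Finset.mem_powerset.1 (Finset.mem_filter.1 hX).1
    exact logRatio_prod_eq_sum X (fun γ hγ => ha' γ (hXs hγ)) (fun γ hγ => hb' γ (hXs hγ))
  -- ONE tame tilt letter, from run A's KP margin (p620730 §3)
  obtain ⟨φA, hφA, heA, hbA⟩ := tiltLetter_of_kpMargin inc (Λ \ O) a (fun γ => Real.log (b γ) - Real.log (a γ)) aszA
    ha' hr0.le hKPa (fun X => Real.log (∏ γ ∈ X, b γ) - Real.log (∏ γ ∈ X, a γ)) hh
  -- FILE 1 §2 (R2 + the origin-disc road), the tame class set rewritten as the sub-gas on `Λ ∖ O` (p620730 §4)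
  have key := one_sub_affinity_classLaw_le_wildMass_add_tameTilt (T := T) (W := W)
    (A := fun X => ∏ γ ∈ X, a γ) (B := fun X => ∏ γ ∈ X, b γ) hW hA hB hr φA hφA
    (fun s hs => by rw [hTW]; exact heA s hs) hbA
  have e : 2 * (2 * ∑ γ ∈ Λ \ O, aszA γ) / r ^ 2 = 4 * (∑ γ ∈ Λ \ O, aszA γ) / r ^ 2 := by ring
  rw [e] at key
  exact key

/-! ## §2 ALONG `K`: the (H) letter from (KR) + (V‑a) + ONE run's (V‑b)-margin in abstract form — regime-free [folklore] -/

/-- **★★★ THE AFFINITY-DEFECT LETTER OF A KEYED GAS FROM WILD MASSES AND ONE ONE-RUN KP MARGIN, SUMMED OVER KEYS — NO REGIME** [folklore; = p620730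
`affinityDefectLetter_of_kpMargins` with `(hKPb) (h𝔄B) (K₀) (hreg)` DELETED].  Per key `K` and source `|t| ≤ l₀`: a finite polymer family `Λ_K`, BOTH runs'
activities `a, b > 0` on it ((KR)), an over-aged set `O_{K,t}`, bounds `wm_K` on both ONE-RUN wild masses with `Σ√wm_K < ∞` ((V‑a)), radii `r_K > 0` with
`Σ 1∕r_K < ∞` and, for run A ALONE, a weighted real KP margin on `Λ_K ∖ O_{K,t}` at radius `r_K` absorbing `e^{r_K|log b_γ − log a_γ|}` ((V‑b) spent on the
radius), ONE size bound `Σ_{Λ_K∖O} asz_A ≤ 𝔄`.  Then `∃ η ≥ 0`, `Σ_K √η_K < ∞`, and for all `K`, `|t| ≤ l₀` the class laws of the two keyed gases satisfy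
`1 − Σ_T √(p_A p_B) ≤ η_K` — the (H) letter consumed by the landed class-law ∕ TV roads and dag-n20-w5's capstone.  FILE 1 §3 with `𝔅 := 2𝔄`; the finite head
`r_K < 2` is paid inside FILE 1.  Nothing else enters. -/
theorem affinityDefectLetter_of_kpMargin [Std.Refl inc] [Std.Symm inc] {l₀ : ℝ}
    (Λ : ℕ → Finset P) (O : ℕ → ℝ → Finset P) (a b aszA : ℕ → ℝ → P → ℝ)
    (ha : ∀ K t, |t| ≤ l₀ → ∀ γ ∈ Λ K, 0 < a K t γ) (hb : ∀ K t, |t| ≤ l₀ → ∀ γ ∈ Λ K, 0 < b K t γ)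
    (wm : ℕ → ℝ) (hwm : ∀ K, 0 ≤ wm K)
    (hwildA : ∀ K t, |t| ≤ l₀ →
      (∑ X ∈ ((Λ K).powerset.filter (fun X => IsCompatible inc X)).filter (fun X => ¬ Disjoint X (O K t)), ∏ γ ∈ X, a K t γ)
        / (∑ Y ∈ (Λ K).powerset with IsCompatible inc Y, ∏ γ ∈ Y, a K t γ) ≤ wm K)
    (hwildB : ∀ K t, |t| ≤ l₀ →
      (∑ X ∈ ((Λ K).powerset.filter (fun X => IsCompatible inc X)).filter (fun X => ¬ Disjoint X (O K t)), ∏ γ ∈ X, b K t γ)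
        / (∑ Y ∈ (Λ K).powerset with IsCompatible inc Y, ∏ γ ∈ Y, b K t γ) ≤ wm K)
    (hws : Summable fun K => Real.sqrt (wm K))
    (r : ℕ → ℝ) (hr : ∀ K, 0 < r K) (hrs : Summable fun K => 1 / r K)
    {𝔄 : ℝ} (h𝔄 : 0 ≤ 𝔄)
    (h𝔄A : ∀ K t, |t| ≤ l₀ → ∑ γ ∈ Λ K \ O K t, aszA K t γ ≤ 𝔄)
    (hKPa : ∀ K t, |t| ≤ l₀ → ∀ γ ∈ Λ K \ O K t, ∑ γ' ∈ (Λ K \ O K t) with inc γ' γ,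
      a K t γ' * Real.exp (r K * |Real.log (b K t γ') - Real.log (a K t γ')|) * Real.exp (aszA K t γ') ≤ aszA K t γ) :
    ∃ η : ℕ → ℝ, (∀ K, 0 ≤ η K) ∧ Summable (fun K => Real.sqrt (η K)) ∧
      ∀ K t, |t| ≤ l₀ →
        1 - ∑ X ∈ (Λ K).powerset with IsCompatible inc X,
          Real.sqrt (((∏ γ ∈ X, a K t γ) / ∑ Y ∈ (Λ K).powerset with IsCompatible inc Y, ∏ γ ∈ Y, a K t γ)
            * ((∏ γ ∈ X, b K t γ) / ∑ Y ∈ (Λ K).powerset with IsCompatible inc Y, ∏ γ ∈ Y, b K t γ)) ≤ η K := by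
  -- class-set data of the keyed gases (as in p620730 §6)
  have hW : ∀ K t, ((Λ K).powerset.filter (fun X => IsCompatible inc X)).filter (fun X => ¬ Disjoint X (O K t))
      ⊆ (Λ K).powerset.filter (fun X => IsCompatible inc X) := fun K t => Finset.filter_subset _ _
  have hXΛ : ∀ K, ∀ X ∈ (Λ K).powerset.filter (fun X => IsCompatible inc X), X ⊆ Λ K :=
    fun K X hX => Finset.mem_powerset.1 (Finset.mem_filter.1 hX).1
  have hA : ∀ K t, |t| ≤ l₀ → ∀ X ∈ (Λ K).powerset.filter (fun X => IsCompatible inc X), 0 < ∏ γ ∈ X, a K t γ :=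
    fun K t ht X hX => Finset.prod_pos fun γ hγ => ha K t ht γ (hXΛ K X hX hγ)
  have hB : ∀ K t, |t| ≤ l₀ → ∀ X ∈ (Λ K).powerset.filter (fun X => IsCompatible inc X), 0 < ∏ γ ∈ X, b K t γ :=
    fun K t ht X hX => Finset.prod_pos fun γ hγ => hb K t ht γ (hXΛ K X hX hγ)
  -- ONE tame tilt letter at every `(K,t)` (p620730 §3 on `Λ K ∖ O K t`), transported to the tame class set (p620730 §4)
  have htilt : ∀ K t, |t| ≤ l₀ → ∃ φ : ℂ → ℂ,
      DifferentiableOn ℂ φ (Metric.closedBall 0 (r K)) ∧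
      (∀ s ∈ Metric.closedBall (0:ℂ) (r K), Complex.exp (φ s)
        = (∑ τ ∈ ((Λ K).powerset.filter (fun X => IsCompatible inc X))
              \ ((Λ K).powerset.filter (fun X => IsCompatible inc X)).filter (fun X => ¬ Disjoint X (O K t)),
            ((∏ γ ∈ τ, a K t γ : ℝ) : ℂ)
              * Complex.exp (s * ((Real.log (∏ γ ∈ τ, b K t γ) - Real.log (∏ γ ∈ τ, a K t γ) : ℝ) : ℂ)))
          / ∑ τ ∈ ((Λ K).powerset.filter (fun X => IsCompatible inc X))
              \ ((Λ K).powerset.filter (fun X => IsCompatible inc X)).filter (fun X => ¬ Disjoint X (O K t)),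
            ((∏ γ ∈ τ, a K t γ : ℝ) : ℂ)) ∧
      (∀ s ∈ Metric.closedBall (0:ℂ) (r K), ‖φ s‖ ≤ 2 * 𝔄) := by
    intro K t ht
    have ha' : ∀ γ ∈ Λ K \ O K t, 0 < a K t γ := fun γ hγ => ha K t ht γ (Finset.sdiff_subset hγ)
    have hb' : ∀ γ ∈ Λ K \ O K t, 0 < b K t γ := fun γ hγ => hb K t ht γ (Finset.sdiff_subset hγ)
    have hh : ∀ X ∈ (Λ K \ O K t).powerset.filter (fun X => IsCompatible inc X),
        (fun X => Real.log (∏ γ ∈ X, b K t γ) - Real.log (∏ γ ∈ X, a K t γ)) X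
          = ∑ γ ∈ X, (Real.log (b K t γ) - Real.log (a K t γ)) := by
      intro X hX
      have hXs : X ⊆ Λ K \ O K t := Finset.mem_powerset.1 (Finset.mem_filter.1 hX).1
      exact logRatio_prod_eq_sum X (fun γ hγ => ha' γ (hXs hγ)) (fun γ hγ => hb' γ (hXs hγ))
    obtain ⟨φA, hφA, heA, hbA⟩ := tiltLetter_of_kpMargin inc (Λ K \ O K t) (a K t)
      (fun γ => Real.log (b K t γ) - Real.log (a K t γ)) (aszA K t) ha' (hr K).le (hKPa K t ht)
      (fun X => Real.log (∏ γ ∈ X, b K t γ) - Real.log (∏ γ ∈ X, a K t γ)) hh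
    refine ⟨φA, hφA, ?_, ?_⟩
    · intro s hs; rw [tameFamilies_eq_compatible_sdiff]; exact heA s hs
    · intro s hs; exact (hbA s hs).trans (by linarith [h𝔄A K t ht])
  have h2𝔄 : (0:ℝ) ≤ 2 * 𝔄 := by positivity
  obtain ⟨η, hη0, hηs, hη⟩ := affinityDefectLetter_of_tameTilt
    (fun K => (Λ K).powerset.filter (fun X => IsCompatible inc X))
    (fun K t X => ∏ γ ∈ X, a K t γ) (fun K t X => ∏ γ ∈ X, b K t γ) hA hB
    (fun K t => ((Λ K).powerset.filter (fun X => IsCompatible inc X)).filter (fun X => ¬ Disjoint X (O K t))) hW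
    wm hwm hwildA hwildB hws r hr hrs h2𝔄 htilt
  exact ⟨η, hη0, hηs, hη⟩

/-- **★ COROLLARY — THE SUMMABLE HELLINGER RATE OF THE KEYED GAS, REGIME-FREE** [folklore]: under the hypotheses of `affinityDefectLetter_of_kpMargin`,
`∃ ρ ≥ 0` summable with `√(1 − Σ_T √(p_A p_B)) ≤ ρ_K` for all `K`, `|t| ≤ l₀` — the input shape of the per-set-TV ∕ class-law roads. -/
theorem hellingerRate_of_kpMargin [Std.Refl inc] [Std.Symm inc] {l₀ : ℝ}
    (Λ : ℕ → Finset P) (O : ℕ → ℝ → Finset P) (a b aszA : ℕ → ℝ → P → ℝ)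
    (ha : ∀ K t, |t| ≤ l₀ → ∀ γ ∈ Λ K, 0 < a K t γ) (hb : ∀ K t, |t| ≤ l₀ → ∀ γ ∈ Λ K, 0 < b K t γ)
    (wm : ℕ → ℝ) (hwm : ∀ K, 0 ≤ wm K)
    (hwildA : ∀ K t, |t| ≤ l₀ →
      (∑ X ∈ ((Λ K).powerset.filter (fun X => IsCompatible inc X)).filter (fun X => ¬ Disjoint X (O K t)), ∏ γ ∈ X, a K t γ)
        / (∑ Y ∈ (Λ K).powerset with IsCompatible inc Y, ∏ γ ∈ Y, a K t γ) ≤ wm K)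
    (hwildB : ∀ K t, |t| ≤ l₀ →
      (∑ X ∈ ((Λ K).powerset.filter (fun X => IsCompatible inc X)).filter (fun X => ¬ Disjoint X (O K t)), ∏ γ ∈ X, b K t γ)
        / (∑ Y ∈ (Λ K).powerset with IsCompatible inc Y, ∏ γ ∈ Y, b K t γ) ≤ wm K)
    (hws : Summable fun K => Real.sqrt (wm K))
    (r : ℕ → ℝ) (hr : ∀ K, 0 < r K) (hrs : Summable fun K => 1 / r K)
    {𝔄 : ℝ} (h𝔄 : 0 ≤ 𝔄)
    (h𝔄A : ∀ K t, |t| ≤ l₀ → ∑ γ ∈ Λ K \ O K t, aszA K t γ ≤ 𝔄)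
    (hKPa : ∀ K t, |t| ≤ l₀ → ∀ γ ∈ Λ K \ O K t, ∑ γ' ∈ (Λ K \ O K t) with inc γ' γ,
      a K t γ' * Real.exp (r K * |Real.log (b K t γ') - Real.log (a K t γ')|) * Real.exp (aszA K t γ') ≤ aszA K t γ) :
    ∃ ρ : ℕ → ℝ, Summable ρ ∧ (∀ K, 0 ≤ ρ K) ∧ ∀ K t, |t| ≤ l₀ →
      Real.sqrt (1 - ∑ X ∈ (Λ K).powerset with IsCompatible inc X,
          Real.sqrt (((∏ γ ∈ X, a K t γ) / ∑ Y ∈ (Λ K).powerset with IsCompatible inc Y, ∏ γ ∈ Y, a K t γ)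
            * ((∏ γ ∈ X, b K t γ) / ∑ Y ∈ (Λ K).powerset with IsCompatible inc Y, ∏ γ ∈ Y, b K t γ))) ≤ ρ K := by
  obtain ⟨η, _, hs, hη⟩ := affinityDefectLetter_of_kpMargin inc Λ O a b aszA ha hb wm hwm hwildA hwildB hws r hr hrs h𝔄 h𝔄A hKPa
  exact exists_summable_sqrt_rate hs hη

/-! ## §3 Toy (A6): the hypothesis set of §1 is inhabited — no polymers [folklore] -/

/-- With NO polymers (`Λ = O = ∅`) the keyed gas has the single empty class with weight `1` for both runs: the KP margin is vacuous, there is NO regime clause to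
check any more, and §1 at radius `2` returns `0 ≤ 0 + 0` — source-free non-vacuity of the antecedent. -/
theorem toy_noPolymers [Std.Refl inc] [Std.Symm inc] (a b aszA : P → ℝ) :
    1 - ∑ X ∈ (∅ : Finset P).powerset with IsCompatible inc X,
        Real.sqrt (((∏ γ ∈ X, a γ) / ∑ Y ∈ (∅ : Finset P).powerset with IsCompatible inc Y, ∏ γ ∈ Y, a γ)
          * ((∏ γ ∈ X, b γ) / ∑ Y ∈ (∅ : Finset P).powerset with IsCompatible inc Y, ∏ γ ∈ Y, b γ))
      ≤ max ((∑ X ∈ ((∅ : Finset P).powerset.filter (fun X => IsCompatible inc X)).filter (fun X => ¬ Disjoint X ∅), ∏ γ ∈ X, a γ)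
              / ∑ Y ∈ (∅ : Finset P).powerset with IsCompatible inc Y, ∏ γ ∈ Y, a γ)
            ((∑ X ∈ ((∅ : Finset P).powerset.filter (fun X => IsCompatible inc X)).filter (fun X => ¬ Disjoint X ∅), ∏ γ ∈ X, b γ)
              / ∑ Y ∈ (∅ : Finset P).powerset with IsCompatible inc Y, ∏ γ ∈ Y, b γ)
        + 4 * (∑ γ ∈ (∅ : Finset P) \ ∅, aszA γ) / (2:ℝ) ^ 2 :=
  one_sub_affinity_keyedGas_le_wildMass_add_kpMargin inc ∅ ∅ a b aszA (by simp) (by simp) (le_refl (2:ℝ)) (by simp)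

end Summit.QuantumFields.YangMills.BalabanUVNodes.N19TameTiltLetterOfKPMarginRegimeFree

end
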